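import Literature.Computability.AlgebraicComplexity.LaserMethodTypes
import Literature.Computability.AlgebraicComplexity.MultinomialEntropy
import Literature.Probability.Entropy.BinaryRelativeEntropy
import HarnessLib

/-!
# Hypergeometric concentration for type classes, by the method of types
(the "concentration bounds" of Vassilevska Williams–Xu–Xu–Zhou 2024, §6.6, first type of holes)
— proved

Topic `Literature/Computability/AlgebraicComplexity`.  In §6.6 of Vassilevska Williams–Xu–Xu–Zhou,
*New bounds for matrix multiplication: from alpha to omega* (SODA 2024, arXiv:2307.07970), the fraction
of holes of the first type is controlled by taking "a random level-1 `X`-block in `𝒯*`" — a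
uniformly random word with prescribed letter counts on each position class — and asserting that its
empirical distribution on various sub-classes of positions (odd positions of a split type, …) is
within `o(1)` of the prescribed one "with `1 − 1/poly(n)` probability, by concentration bounds".
The underlying estimate is hypergeometric concentration (sampling without replacement); this file
PROVES it in counting form by the METHOD OF TYPES, with an explicit exponential bound, from the
tree's Lemma 3.3 (`MultinomialEntropy.lean`) and the log-sum / Pinsker inequalities
(`Literature/Probability/Entropy/BinaryRelativeEntropy.lean`):

* `letterCountOn`, `typeClassOn`, `card_typeClassOn_eq_multinomial` — counts of a word on a set of
  positions; words on an arbitrary finite position set with prescribed counts and their number;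
* `card_fibre_le_mul` — `#{w ∈ T(k) | count_P(w) = k'} ≤ |T_P(k')| · |T_{Pᶜ}(k − k')|`
  (restriction to `P` and `Pᶜ` is injective);
* `sq_sub_le_two_mul_binaryKL` (Pinsker with endpoints), `jensenGap_negMulLog_pointwise` (the
  Jensen gap of `η = −x log x` under a two-point mixture is a sum of two relative entropies);
* `card_fibre_le_of_far` — **a fibre whose counts are `δ`-far from proportional in some letter has at
  most `(M+1)^{|A|} e^{−mδ²/2} |T(k)|` words**;
* `typeClass_restriction_concentration` — **the union bound over fibres**:
  `#{w ∈ T(k) | ∃ a, |count_P(w)(a)/m − k(a)/M| ≥ δ} ≤ (m+1)^{|A|}(M+1)^{|A|} e^{−mδ²/2} |T(k)|`.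

Everything is proved; the definitions are `letterCountOn` and `typeClassOn`; no named facts.

## References

* V. Vassilevska Williams, Y. Xu, Z. Xu, R. Zhou, *New bounds for matrix multiplication: from alpha
  to omega*, SODA 2024, arXiv:2307.07970 (held: `paper:arxiv-2307.07970`), §6.6 (first type of
  holes: "by concentration bounds … with `1 − 1/poly(n)` probability"). [VassilevskaWilliamsXuXuZhou2024]
* T. M. Cover, J. A. Thomas, *Elements of Information Theory*, 2nd ed., Wiley 2006, §11.1 (method of
  types: Thm. 11.1.4) and Lemma 11.6.1 (Pinsker). [CoverThomas2006]
-/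

noncomputable section

open scoped BigOperators
open Finset Real

namespace Literature.Computability.AlgebraicComplexity

open Literature.Probability.Entropy (binaryKL sum_mul_log_div_le binaryKL_le_sum_mul_log_div
  sq_sub_le_two_mul_binaryKL_mul_max)

/-! ## Letter counts on a set of positions -/

section Counts

variable {A : Type*} [DecidableEq A] {M : ℕ}

/-- **The letter counts of a word on a set of positions `P`** (the type of `w|_P`). [folklore] -/
def letterCountOn (P : Finset (Fin M)) (w : Fin M → A) : A → ℕ := fun a => (P.filter fun p => w p = a).card

/-- Unfolding. [folklore] -/
theorem letterCountOn_apply (P : Finset (Fin M)) (w : Fin M → A) (a : A) :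
    letterCountOn P w a = (P.filter fun p => w p = a).card := rfl

/-- `∑_a count_P(a) = |P|`. [folklore] -/
theorem sum_letterCountOn [Fintype A] (P : Finset (Fin M)) (w : Fin M → A) : ∑ a, letterCountOn P w a = P.card := by
  unfold letterCountOn
  exact (card_eq_sum_card_fiberwise (f := w) (s := P) (t := univ) fun _ _ => mem_univ _).symm

/-- On all positions the counts are the type. [folklore] -/
theorem letterCountOn_univ (w : Fin M → A) : letterCountOn univ w = letterCount w := rfl

/-- Counts on `P` and on `Pᶜ` add up to the type. [folklore] -/
theorem letterCountOn_add_compl (P : Finset (Fin M)) (w : Fin M → A) (a : A) :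
    letterCountOn P w a + letterCountOn Pᶜ w a = letterCount w a := by
  rw [letterCountOn_apply, letterCountOn_apply, letterCount_apply, ← filter_union_filter_not_eq (fun p => p ∈ P) (univ.filter fun m => w m = a),
    card_union_of_disjoint (disjoint_filter_filter_not _ _ _), filter_filter, filter_filter]
  congr 2
  · ext p; simp [and_comm]
  · ext p; simp [and_comm]

/-- Counts on `P` are at most the type. [folklore] -/
theorem letterCountOn_le_letterCount (P : Finset (Fin M)) (w : Fin M → A) (a : A) :
    letterCountOn P w a ≤ letterCount w a := by
  rw [← letterCountOn_add_compl P w a]; exact Nat.le_add_right _ _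

/-- Counts on `P` are at most `|P|`. [folklore] -/
theorem letterCountOn_le_card (P : Finset (Fin M)) (w : Fin M → A) (a : A) : letterCountOn P w a ≤ P.card :=
  card_filter_le _ _

end Counts

/-! ## Words on an arbitrary finite set of positions with prescribed counts -/

section TypeClassOn

variable {A : Type*} [Fintype A] [DecidableEq A]

/-- The words on the position type `X` with letter counts `k`. [folklore] -/
def typeClassOn (X : Type*) [Fintype X] [DecidableEq X] (k : A → ℕ) : Finset (X → A) :=
  univ.filter fun v => ∀ a, (univ.filter fun x => v x = a).card = k a

variable {X : Type*} [Fintype X] [DecidableEq X]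

/-- Membership. [folklore] -/
theorem mem_typeClassOn {k : A → ℕ} {v : X → A} : v ∈ typeClassOn X k ↔ ∀ a, (univ.filter fun x => v x = a).card = k a := by
  simp [typeClassOn]

/-- **`|typeClassOn X k| = binom(|X|; k)`** (transport to `Fin |X|`). [cite: CoverThomas2006, Thm. 11.1.3 (size of a type class)] -/
theorem card_typeClassOn_eq_multinomial (k : A → ℕ) (hk : ∑ a, k a = Fintype.card X) :
    (typeClassOn X k).card = Nat.multinomial univ k := by
  classical
  set e := Fintype.equivFin X
  rw [← card_typeClass_eq_multinomial (Fintype.card X) k hk]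
  refine card_bij (fun v _ => v ∘ e.symm) (fun v hv => ?_) (fun v₁ _ v₂ _ h => ?_) (fun u hu => ?_)
  · rw [mem_typeClass]
    funext a
    have := (mem_typeClassOn.1 hv) a
    rw [letterCount_apply, ← this]
    refine card_bij (fun i _ => e.symm i) (fun i hi => ?_) (fun i₁ _ i₂ _ h => e.symm.injective h) (fun x hx => ?_)
    · simpa using hi
    · exact ⟨e x, by simpa using hx, by simp⟩
  · funext x
    have := congrFun h (e x)
    simpa using this
  · refine ⟨u ∘ e, mem_typeClassOn.2 fun a => ?_, by funext i; simp⟩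
    have := congrFun (mem_typeClass.1 hu) a
    rw [letterCount_apply] at this
    rw [← this]
    refine card_bij (fun x _ => e x) (fun x hx => ?_) (fun x₁ _ x₂ _ h => e.injective h) (fun i hi => ?_)
    · simpa using hx
    · exact ⟨e.symm i, by simpa using hi, by simp⟩

/-- `|typeClassOn X k| ≤ exp(|X| ∑ η(k/|X|))` (Lemma 3.3, upper half). [cite: CoverThomas2006, Thm. 11.1.3] -/
theorem card_typeClassOn_le_exp (k : A → ℕ) (hk : ∑ a, k a = Fintype.card X) :
    ((typeClassOn X k).card : ℝ) ≤ Real.exp ((Fintype.card X : ℝ) * ∑ a, negMulLog ((k a : ℝ) / Fintype.card X)) := by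
  rw [card_typeClassOn_eq_multinomial k hk]
  exact multinomial_le_exp_mul_sum_negMulLog k hk

end TypeClassOn

/-! ## The fibre of a restriction type is small: counting -/

section Fibre

variable {A : Type*} [Fintype A] [DecidableEq A] {M : ℕ}

/-- **Restriction is injective into (pattern on `P`) × (pattern on `Pᶜ`)**, and a word of type `k`
with counts `k'` on `P` has counts `k − k'` on `Pᶜ`; hence
`#{w ∈ T(k) | count_P(w) = k'} ≤ |typeClassOn P k'| · |typeClassOn Pᶜ (k − k')|`. [cite: CoverThomas2006, §11.1 (method of types)] -/
theorem card_fibre_le_mul (k : A → ℕ) (P : Finset (Fin M)) (k' : A → ℕ) :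
    ((typeClass M k).filter fun w => letterCountOn P w = k').card ≤
      (typeClassOn ↥P k').card * (typeClassOn ↥(Pᶜ) (fun a => k a - k' a)).card := by
  classical
  rw [← card_product]
  refine card_le_card_of_injOn (fun w => (fun p : ↥P => w p, fun p : ↥(Pᶜ) => w p)) (fun w hw => ?_) (fun w₁ hw₁ w₂ hw₂ h => ?_)
  · rw [mem_coe, mem_filter] at hw
    obtain ⟨hwk, hwk'⟩ := hw
    rw [mem_typeClass] at hwk
    rw [mem_coe, mem_product]
    constructor
    · refine mem_typeClassOn.2 fun a => ?_
      rw [← hwk', letterCountOn_apply]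
      refine card_bij (fun p _ => p.1) (fun p hp => ?_) (fun p₁ _ p₂ _ h => Subtype.ext h) (fun p hp => ?_)
      · rw [mem_filter] at hp ⊢; exact ⟨p.2, hp.2⟩
      · rw [mem_filter] at hp; exact ⟨⟨p, hp.1⟩, by simp [hp.2], rfl⟩
    · refine mem_typeClassOn.2 fun a => ?_
      have hadd := letterCountOn_add_compl P w a
      rw [hwk, hwk'] at hadd
      have : letterCountOn Pᶜ w a = k a - k' a := by omega
      rw [← this, letterCountOn_apply]
      refine card_bij (fun p _ => p.1) (fun p hp => ?_) (fun p₁ _ p₂ _ h => Subtype.ext h) (fun p hp => ?_)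
      · rw [mem_filter] at hp ⊢; exact ⟨p.2, hp.2⟩
      · rw [mem_filter] at hp; exact ⟨⟨p, hp.1⟩, by simp [hp.2], rfl⟩
  · simp only [Prod.mk.injEq] at h
    obtain ⟨h1, h2⟩ := h
    funext p
    by_cases hp : p ∈ P
    · exact congrFun h1 ⟨p, hp⟩
    · exact congrFun h2 ⟨p, mem_compl.2 hp⟩

end Fibre

/-! ## Analytic lemmas: Pinsker with endpoints, the Jensen gap of the entropy -/

section Analytic

/-- **Binary Pinsker with endpoints**: `(x − y)² ≤ 2 kl(x ‖ y)` for `x ∈ [0,1]`, `y ∈ (0,1)` (the tree's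
Dewan–Muirhead form `(x−y)² ≤ 2 kl max{x,y}` on the open square, and the endpoint values
`kl(0‖y) = −log(1−y) ≥ y`, `kl(1‖y) = −log y ≥ 1 − y`). [cite: CoverThomas2006, Lemma 11.6.1 (Pinsker's inequality)] -/
theorem sq_sub_le_two_mul_binaryKL {x y : ℝ} (hx0 : 0 ≤ x) (hx1 : x ≤ 1) (hy0 : 0 < y) (hy1 : y < 1) :
    (x - y) ^ 2 ≤ 2 * binaryKL x y := by
  rcases hx0.eq_or_lt with rfl | hx0'
  · -- `x = 0`: `kl = -log(1-y) ≥ y ≥ y²/2`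
    have hkl : binaryKL 0 y = -Real.log (1 - y) := by
      rw [Literature.Probability.Entropy.binaryKL_def]
      simp
    rw [hkl]
    have h1 : Real.log (1 - y) ≤ -y := by
      have := Real.log_le_sub_one_of_pos (by linarith : (0:ℝ) < 1 - y); linarith
    nlinarith
  rcases hx1.lt_or_eq with hx1' | rfl
  · have h := sq_sub_le_two_mul_binaryKL_mul_max hx0' hx1' hy0 hy1
    have hkl0 : 0 ≤ binaryKL x y := Literature.Probability.Entropy.binaryKL_nonneg hx0 hx1 hy0 hy1
    have hmax : max x y ≤ 1 := max_le hx1 hy1.le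
    calc (x - y) ^ 2 ≤ 2 * binaryKL x y * max x y := h
      _ ≤ 2 * binaryKL x y * 1 := mul_le_mul_of_nonneg_left hmax (by positivity)
      _ = 2 * binaryKL x y := mul_one _
  · -- `x = 1`: `kl = -log y ≥ 1 - y ≥ (1-y)²/2`
    have hkl : binaryKL 1 y = -Real.log y := by
      rw [Literature.Probability.Entropy.binaryKL_def]
      simp
    rw [hkl]
    have h1 : Real.log y ≤ y - 1 := Real.log_le_sub_one_of_pos hy0
    nlinarith

/-- `t (log u − log v) = t log(u/v)` when `t = 0` or `u, v > 0`. [folklore] -/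
theorem mul_log_sub_log_eq {t u v : ℝ} (h : t = 0 ∨ (0 < u ∧ 0 < v)) : t * (Real.log u - Real.log v) = t * Real.log (u / v) := by
  rcases h with rfl | ⟨hu, hv⟩
  · simp
  · rw [Real.log_div hu.ne' hv.ne']

/-- **The Jensen gap of `η(x) = −x log x` under a two-point mixture, pointwise**: for counts
`t₁, t₂ ≥ 0` on parts of sizes `m₁, m₂ > 0`,
`m₁ η(t₁/m₁) + m₂ η(t₂/m₂) − (m₁+m₂) η((t₁+t₂)/(m₁+m₂)) = −[t₁ log((t₁/m₁)/q̄) + t₂ log((t₂/m₂)/q̄)]`,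
`q̄ = (t₁+t₂)/(m₁+m₂)`. [cite: CoverThomas2006, §11.1 (proof of Thm. 11.1.4)] -/
theorem jensenGap_negMulLog_pointwise {t₁ t₂ m₁ m₂ : ℝ} (ht₁ : 0 ≤ t₁) (ht₂ : 0 ≤ t₂) (hm₁ : 0 < m₁) (hm₂ : 0 < m₂) :
    m₁ * negMulLog (t₁ / m₁) + m₂ * negMulLog (t₂ / m₂) - (m₁ + m₂) * negMulLog ((t₁ + t₂) / (m₁ + m₂)) =
      -(t₁ * Real.log ((t₁ / m₁) / ((t₁ + t₂) / (m₁ + m₂))) + t₂ * Real.log ((t₂ / m₂) / ((t₁ + t₂) / (m₁ + m₂)))) := by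
  have hm : 0 < m₁ + m₂ := by linarith
  -- the two `log` splittings (valid termwise: `t = 0` or arguments positive)
  have h1 : t₁ * (Real.log (t₁ / m₁) - Real.log ((t₁ + t₂) / (m₁ + m₂))) = t₁ * Real.log ((t₁ / m₁) / ((t₁ + t₂) / (m₁ + m₂))) := by
    refine mul_log_sub_log_eq ?_
    rcases ht₁.eq_or_lt with h0 | hpos
    · left; exact h0.symm
    · right; exact ⟨div_pos hpos hm₁, div_pos (by linarith) hm⟩
  have h2 : t₂ * (Real.log (t₂ / m₂) - Real.log ((t₁ + t₂) / (m₁ + m₂))) = t₂ * Real.log ((t₂ / m₂) / ((t₁ + t₂) / (m₁ + m₂))) := by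
    refine mul_log_sub_log_eq ?_
    rcases ht₂.eq_or_lt with h0 | hpos
    · left; exact h0.symm
    · right; exact ⟨div_pos hpos hm₂, div_pos (by linarith) hm⟩
  -- clear the denominators in front of the logarithms
  have c1 : m₁ * negMulLog (t₁ / m₁) = -(t₁ * Real.log (t₁ / m₁)) := by
    rw [negMulLog, show m₁ * (-(t₁ / m₁) * Real.log (t₁ / m₁)) = -(m₁ * (t₁ / m₁)) * Real.log (t₁ / m₁) by ring,
      mul_div_cancel₀ _ hm₁.ne']
    ring
  have c2 : m₂ * negMulLog (t₂ / m₂) = -(t₂ * Real.log (t₂ / m₂)) := by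
    rw [negMulLog, show m₂ * (-(t₂ / m₂) * Real.log (t₂ / m₂)) = -(m₂ * (t₂ / m₂)) * Real.log (t₂ / m₂) by ring,
      mul_div_cancel₀ _ hm₂.ne']
    ring
  have c3 : (m₁ + m₂) * negMulLog ((t₁ + t₂) / (m₁ + m₂)) = -((t₁ + t₂) * Real.log ((t₁ + t₂) / (m₁ + m₂))) := by
    rw [negMulLog, show (m₁ + m₂) * (-((t₁ + t₂) / (m₁ + m₂)) * Real.log ((t₁ + t₂) / (m₁ + m₂))) =
      -((m₁ + m₂) * ((t₁ + t₂) / (m₁ + m₂))) * Real.log ((t₁ + t₂) / (m₁ + m₂)) by ring, mul_div_cancel₀ _ hm.ne']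
    ring
  rw [c1, c2, c3]
  linear_combination (-1 : ℝ) * h1 + (-1 : ℝ) * h2

end Analytic

/-! ## The fibre of a far restriction type is exponentially small -/

section FarFibre

variable {A : Type*} [Fintype A] [DecidableEq A] {M : ℕ}

/-- If `∑ k = M` and `k a₀ = M` then `k` vanishes off `a₀`. [folklore] -/
theorem eq_zero_of_sum_eq_of_apply_eq {k : A → ℕ} (hk : ∑ a, k a = M) {a₀ : A} (h0 : k a₀ = M) {a : A} (ha : a ≠ a₀) : k a = 0 := by
  have h := Finset.add_sum_erase (univ : Finset A) k (mem_univ a₀)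
  rw [hk, h0] at h
  have hz : ∑ x ∈ univ.erase a₀, k x = 0 := by omega
  exact (sum_eq_zero_iff.1 hz) a (mem_erase.2 ⟨ha, mem_univ a⟩)

/-- **The far-fibre bound** (method of types + Pinsker): for a type `k` of `M` letters, a set `P` of
`m ≥ 1` positions and counts `k'` on `P` that are `δ`-far from proportional in some letter
(`δ ≤ |k'(a₀)/m − k(a₀)/M|`, `δ > 0`), the number of words of type `k` with counts `k'` on `P` is at most
`(M+1)^{|A|} e^{−m δ²/2} |T(k)|`. [cite: CoverThomas2006, Thm. 11.1.4 (probability of a type class ≤ 2^{−n D(P‖Q)}) and Lemma 11.6.1] -/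
theorem card_fibre_le_of_far (k : A → ℕ) (hk : ∑ a, k a = M) (P : Finset (Fin M)) (hm : 0 < P.card)
    (k' : A → ℕ) {a₀ : A} {δ : ℝ} (hδ : 0 < δ)
    (hfar : δ ≤ |(k' a₀ : ℝ) / P.card - (k a₀ : ℝ) / M|) :
    (((typeClass M k).filter fun w => letterCountOn P w = k').card : ℝ) ≤
      ((M : ℝ) + 1) ^ Fintype.card A * Real.exp (-(P.card * δ ^ 2 / 2)) * (typeClass M k).card := by
  classical
  set m := P.card with hmdef
  set F := (typeClass M k).filter fun w => letterCountOn P w = k' with hF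
  rcases F.eq_empty_or_nonempty with hF0 | ⟨w, hw⟩
  · rw [hF0, card_empty, Nat.cast_zero]; positivity
  -- a word in the fibre: `k' ≤ k`, `∑ k' = m`
  rw [hF, mem_filter, mem_typeClass] at hw
  obtain ⟨hwk, hwk'⟩ := hw
  have hle : ∀ a, k' a ≤ k a := fun a => by rw [← hwk, ← hwk']; exact letterCountOn_le_letterCount P w a
  have hk' : ∑ a, k' a = m := by rw [← hwk']; exact sum_letterCountOn P w
  have hk'le : ∀ a, k' a ≤ m := fun a => by rw [← hwk']; exact letterCountOn_le_card P w a
  -- `a₀` carries mass, and not all of it: `0 < k a₀ < M`; also `m < M`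
  have hmR : (0 : ℝ) < m := by exact_mod_cast hm
  have hMpos : 0 < M := lt_of_lt_of_le hm ((card_le_univ P).trans_eq (by simp))
  have hMR : (0 : ℝ) < M := by exact_mod_cast hMpos
  have hka₀ : k a₀ ≠ 0 := by
    intro h0
    have h0' : k' a₀ = 0 := Nat.eq_zero_of_le_zero (h0 ▸ hle a₀)
    rw [h0, h0'] at hfar; simp at hfar; linarith
  have hkM : k a₀ < M := by
    refine lt_of_le_of_ne ?_ (fun hEq => ?_)
    · rw [← hk]; exact single_le_sum (fun _ _ => Nat.zero_le _) (mem_univ a₀)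
    · -- all mass on `a₀` ⇒ `k' a₀ = m` ⇒ not far
      have hk'a₀ : k' a₀ = m := by
        have hothers : ∀ a, a ≠ a₀ → k' a = 0 := fun a ha =>
          Nat.eq_zero_of_le_zero ((hle a).trans_eq (eq_zero_of_sum_eq_of_apply_eq hk hEq ha))
        have h := Finset.add_sum_erase (univ : Finset A) k' (mem_univ a₀)
        rw [hk', sum_eq_zero (fun a ha => hothers a (mem_erase.1 ha).1), add_zero] at h
        exact h
      rw [hEq, hk'a₀, div_self hmR.ne', div_self hMR.ne', sub_self, abs_zero] at hfar
      linarith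
  have hmM : m < M := by
    by_contra hge
    rw [not_lt] at hge
    have hmMe : m = M := le_antisymm ((card_le_univ P).trans_eq (by simp)) hge
    have hPu : P = univ := eq_univ_of_card P (by rw [← hmdef, hmMe]; simp)
    have hkk : k' = k := by rw [← hwk', ← hwk, hPu, letterCountOn_univ]
    rw [hkk, hmMe, sub_self, abs_zero] at hfar
    linarith
  have hMm : (0 : ℝ) < (M : ℝ) - m := by
    have : (m : ℝ) < M := by exact_mod_cast hmM
    linarith
  have hMmN : ((M - m : ℕ) : ℝ) = (M : ℝ) - m := Nat.cast_sub hmM.le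
  -- the three distributions
  set Q₁ : A → ℝ := fun a => (k' a : ℝ) / m with hQ₁
  set Q₂ : A → ℝ := fun a => ((k a : ℝ) - k' a) / ((M : ℝ) - m) with hQ₂
  set Qb : A → ℝ := fun a => (k a : ℝ) / M with hQb
  -- Step B1: the fibre is bounded by the two type-class sizes, hence by entropies
  have hcardP : Fintype.card ↥P = m := by simp [hmdef]
  have hcardPc : Fintype.card ↥(Pᶜ) = M - m := by
    rw [Fintype.card_coe, card_compl, Fintype.card_fin, hmdef]
  have hsum2 : ∑ a, (k a - k' a) = M - m := by
    rw [sum_tsub_distrib _ (fun a _ => hle a), hk, hk']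
  have hB1 : (F.card : ℝ) ≤ Real.exp (m * ∑ a, negMulLog (Q₁ a)) * Real.exp (((M : ℝ) - m) * ∑ a, negMulLog (Q₂ a)) := by
    have h := card_fibre_le_mul k P k'
    have h1 := card_typeClassOn_le_exp (X := ↥P) k' (by rw [hcardP]; exact hk')
    have h2 := card_typeClassOn_le_exp (X := ↥(Pᶜ)) (fun a => k a - k' a) (by rw [hcardPc]; exact hsum2)
    rw [hcardP] at h1
    rw [hcardPc, hMmN] at h2
    have h2' : ((typeClassOn (↥Pᶜ) fun a => k a - k' a).card : ℝ) ≤ Real.exp (((M : ℝ) - m) * ∑ a, negMulLog (Q₂ a)) := by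
      refine h2.trans (le_of_eq ?_)
      congr 2
      refine sum_congr rfl fun a _ => ?_
      rw [hQ₂, Nat.cast_sub (hle a)]
    calc (F.card : ℝ) ≤ ((typeClassOn ↥P k').card : ℝ) * ((typeClassOn (↥Pᶜ) fun a => k a - k' a).card : ℝ) := by
          rw [hF]; exact_mod_cast h
      _ ≤ Real.exp (m * ∑ a, negMulLog (Q₁ a)) * Real.exp (((M : ℝ) - m) * ∑ a, negMulLog (Q₂ a)) :=
          mul_le_mul h1 h2' (Nat.cast_nonneg _) (Real.exp_pos _).le
  -- Step B2: the Jensen gap identity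
  have hB2 : (m : ℝ) * ∑ a, negMulLog (Q₁ a) + ((M : ℝ) - m) * ∑ a, negMulLog (Q₂ a) =
      (M : ℝ) * ∑ a, negMulLog (Qb a) -
        (∑ a, ((k' a : ℝ) * Real.log (Q₁ a / Qb a) + ((k a : ℝ) - k' a) * Real.log (Q₂ a / Qb a))) := by
    rw [mul_sum, mul_sum, mul_sum, ← sum_add_distrib, ← sum_sub_distrib]
    refine sum_congr rfl fun a _ => ?_
    have hk'0 : (0 : ℝ) ≤ k' a := Nat.cast_nonneg _
    have hk'leR : ((k' a : ℕ) : ℝ) ≤ k a := by exact_mod_cast hle a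
    have hkk'0 : (0 : ℝ) ≤ (k a : ℝ) - k' a := by linarith
    have hJ := jensenGap_negMulLog_pointwise hk'0 hkk'0 hmR hMm
    have e1 : (k' a : ℝ) + ((k a : ℝ) - k' a) = k a := by ring
    have e2 : (m : ℝ) + ((M : ℝ) - m) = M := by ring
    rw [e1, e2] at hJ
    simp only [hQ₁, hQ₂, hQb]
    linarith
  -- the support of `k`
  set s : Finset A := univ.filter fun a => k a ≠ 0 with hs
  have hs_pos : ∀ a ∈ s, 0 < Qb a := fun a ha => by
    have : k a ≠ 0 := (mem_filter.1 ha).2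
    simp only [hQb]; exact div_pos (by exact_mod_cast Nat.pos_of_ne_zero this) hMR
  have hoff : ∀ a, a ∉ s → k a = 0 ∧ k' a = 0 := fun a ha => by
    have hka : k a = 0 := by
      by_contra hne; exact ha (mem_filter.2 ⟨mem_univ a, hne⟩)
    exact ⟨hka, Nat.eq_zero_of_le_zero (hka ▸ hle a)⟩
  have ha₀s : a₀ ∈ s := mem_filter.2 ⟨mem_univ _, hka₀⟩
  have hsumQb : ∑ a ∈ s, Qb a = 1 := by
    have : ∑ a, Qb a = 1 := by
      simp only [hQb]; rw [← sum_div, ← Nat.cast_sum, hk, div_self hMR.ne']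
    rw [← this, ← sum_filter_add_sum_filter_not univ (fun a => k a ≠ 0)]
    rw [sum_eq_zero (s := univ.filter fun a => ¬ k a ≠ 0) (fun a ha => by
      have : k a = 0 := by simpa using (mem_filter.1 ha).2
      simp [hQb, this]), add_zero]
  have hsumQ₁ : ∑ a ∈ s, Q₁ a = 1 := by
    have : ∑ a, Q₁ a = 1 := by
      simp only [hQ₁]; rw [← sum_div, ← Nat.cast_sum, hk', div_self hmR.ne']
    rw [← this, ← sum_filter_add_sum_filter_not univ (fun a => k a ≠ 0)]
    rw [sum_eq_zero (s := univ.filter fun a => ¬ k a ≠ 0) (fun a ha => by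
      have hka : k a = 0 := by simpa using (mem_filter.1 ha).2
      have : k' a = 0 := Nat.eq_zero_of_le_zero (hka ▸ hle a)
      simp [hQ₁, this]), add_zero]
  have hsumQ₂ : ∑ a ∈ s, Q₂ a = 1 := by
    have : ∑ a, Q₂ a = 1 := by
      simp only [hQ₂]; rw [← sum_div]
      have : ∑ a, ((k a : ℝ) - k' a) = (M : ℝ) - m := by
        rw [sum_sub_distrib, ← Nat.cast_sum, ← Nat.cast_sum, hk, hk']
      rw [this, div_self hMm.ne']
    rw [← this, ← sum_filter_add_sum_filter_not univ (fun a => k a ≠ 0)]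
    rw [sum_eq_zero (s := univ.filter fun a => ¬ k a ≠ 0) (fun a ha => by
      have hka : k a = 0 := by simpa using (mem_filter.1 ha).2
      have : k' a = 0 := Nat.eq_zero_of_le_zero (hka ▸ hle a)
      simp [hQ₂, hka, this]), add_zero]
  -- Step B3: the second relative entropy is `≥ 0`
  have hB3 : 0 ≤ ∑ a, ((k a : ℝ) - k' a) * Real.log (Q₂ a / Qb a) := by
    have hrw : ∑ a, ((k a : ℝ) - k' a) * Real.log (Q₂ a / Qb a) = ((M : ℝ) - m) * ∑ a ∈ s, Q₂ a * Real.log (Q₂ a / Qb a) := by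
      rw [mul_sum, ← sum_filter_add_sum_filter_not univ (fun a => k a ≠ 0)]
      rw [sum_eq_zero (s := univ.filter fun a => ¬ k a ≠ 0) (fun a ha => by
        have hka : k a = 0 := by simpa using (mem_filter.1 ha).2
        have : k' a = 0 := Nat.eq_zero_of_le_zero (hka ▸ hle a)
        simp [hka, this]), add_zero]
      refine sum_congr rfl fun a _ => ?_
      simp only [hQ₂]; field_simp
    rw [hrw]
    refine mul_nonneg hMm.le ?_
    have hQ₂nn : ∀ a, 0 ≤ Q₂ a := fun a => by
      have h1 : ((k' a : ℕ) : ℝ) ≤ k a := by exact_mod_cast hle a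
      simp only [hQ₂]; exact div_nonneg (by linarith) hMm.le
    have h := sum_mul_log_div_le s Q₂ Qb (fun a _ => hQ₂nn a) hs_pos
    rw [hsumQ₂, hsumQb, div_one, Real.log_one, mul_zero] at h
    exact h
  -- Step B4: the first relative entropy is `≥ m δ²/2`
  have hB4 : (m : ℝ) * δ ^ 2 / 2 ≤ ∑ a, (k' a : ℝ) * Real.log (Q₁ a / Qb a) := by
    have hrw : ∑ a, (k' a : ℝ) * Real.log (Q₁ a / Qb a) = (m : ℝ) * ∑ a ∈ s, Q₁ a * Real.log (Q₁ a / Qb a) := by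
      rw [mul_sum, ← sum_filter_add_sum_filter_not univ (fun a => k a ≠ 0)]
      rw [sum_eq_zero (s := univ.filter fun a => ¬ k a ≠ 0) (fun a ha => by
        have hka : k a = 0 := by simpa using (mem_filter.1 ha).2
        have : k' a = 0 := Nat.eq_zero_of_le_zero (hka ▸ hle a)
        simp [this]), add_zero]
      refine sum_congr rfl fun a _ => ?_
      simp only [hQ₁]; field_simp
    rw [hrw]
    have hKL := binaryKL_le_sum_mul_log_div s {a₀} (singleton_subset_iff.2 ha₀s) Q₁ Qb
      (fun a _ => by simp only [hQ₁]; positivity) hs_pos hsumQ₁ hsumQb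
    rw [sum_singleton, sum_singleton] at hKL
    -- Pinsker at `a₀`
    have hx0 : 0 ≤ Q₁ a₀ := by simp only [hQ₁]; positivity
    have hx1 : Q₁ a₀ ≤ 1 := by
      simp only [hQ₁]; rw [div_le_one hmR]; exact_mod_cast hk'le a₀
    have hy0 : 0 < Qb a₀ := hs_pos a₀ ha₀s
    have hy1 : Qb a₀ < 1 := by
      simp only [hQb]; rw [div_lt_one hMR]; exact_mod_cast hkM
    have hP := sq_sub_le_two_mul_binaryKL hx0 hx1 hy0 hy1
    have hfar' : δ ≤ |Q₁ a₀ - Qb a₀| := hfar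
    have hδsq : δ ^ 2 ≤ (Q₁ a₀ - Qb a₀) ^ 2 := by
      calc δ ^ 2 ≤ |Q₁ a₀ - Qb a₀| ^ 2 := pow_le_pow_left₀ hδ.le hfar' 2
        _ = (Q₁ a₀ - Qb a₀) ^ 2 := sq_abs _
    have : δ ^ 2 / 2 ≤ ∑ a ∈ s, Q₁ a * Real.log (Q₁ a / Qb a) := by linarith
    calc (m : ℝ) * δ ^ 2 / 2 = m * (δ ^ 2 / 2) := by ring
      _ ≤ m * ∑ a ∈ s, Q₁ a * Real.log (Q₁ a / Qb a) := mul_le_mul_of_nonneg_left this hmR.le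
  -- Step B5: assemble
  have hT : Real.exp ((M : ℝ) * ∑ a, negMulLog (Qb a)) ≤ ((M : ℝ) + 1) ^ Fintype.card A * (typeClass M k).card := by
    have h := exp_mul_sum_negMulLog_le_mul_multinomial k hk
    rw [← card_typeClass_eq_multinomial M k hk] at h
    exact h
  calc (F.card : ℝ) ≤ Real.exp (m * ∑ a, negMulLog (Q₁ a)) * Real.exp (((M : ℝ) - m) * ∑ a, negMulLog (Q₂ a)) := hB1
    _ = Real.exp ((M : ℝ) * ∑ a, negMulLog (Qb a) -
          (∑ a, ((k' a : ℝ) * Real.log (Q₁ a / Qb a) + ((k a : ℝ) - k' a) * Real.log (Q₂ a / Qb a)))) := by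
        rw [← Real.exp_add, hB2]
    _ ≤ Real.exp ((M : ℝ) * ∑ a, negMulLog (Qb a) - (m : ℝ) * δ ^ 2 / 2) := by
        refine Real.exp_le_exp.2 ?_
        rw [sum_add_distrib]
        linarith
    _ = Real.exp ((M : ℝ) * ∑ a, negMulLog (Qb a)) * Real.exp (-(m * δ ^ 2 / 2)) := by
        rw [← Real.exp_add]; ring_nf
    _ ≤ ((M : ℝ) + 1) ^ Fintype.card A * (typeClass M k).card * Real.exp (-(m * δ ^ 2 / 2)) :=
        mul_le_mul_of_nonneg_right hT (Real.exp_pos _).le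
    _ = ((M : ℝ) + 1) ^ Fintype.card A * Real.exp (-(m * δ ^ 2 / 2)) * (typeClass M k).card := by ring

end FarFibre

/-! ## The concentration bound -/

section Concentration

variable {A : Type*} [Fintype A] [DecidableEq A] {M : ℕ}

/-- **Hypergeometric concentration for type classes** (method of types): among the words of type `k`
(`∑ k = M` letters), those whose letter frequencies on a fixed set `P` of `m` positions deviate from
the global frequencies by at least `δ > 0` in some letter,
`#{w ∈ T(k) | ∃ a, |count_P(w)(a)/m − k(a)/M| ≥ δ} ≤ (m+1)^{|A|} (M+1)^{|A|} e^{−m δ²/2} |T(k)|`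
— i.e. for a uniformly random word of a type class, the empirical distribution of any `m` coordinates
is `δ`-close to the type except with probability `poly(M) e^{−mδ²/2}` (the "concentration bounds … with
`1 − 1/poly(n)` probability" invoked for random level-1 blocks in §6.6 of VXXZ 2024, made explicit and
exponential).  Proof: the fibre of counts `k'` on `P` has at most `binom(m;k') binom(M−m; k−k')`
words (`card_fibre_le_mul`), `≤ e^{m H(k'/m) + (M−m) H((k−k')/(M−m))}` (Lemma 3.3), and the Jensen
gap `M H(k/M) − m H(k'/m) − (M−m)H(…) = m D(k'/m ‖ k/M) + (M−m) D(… ‖ k/M) ≥ m δ²/2` (log-sum and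
Pinsker), while `e^{M H(k/M)} ≤ (M+1)^{|A|} |T(k)|`; sum over the `≤ (m+1)^{|A|}` values of `k'`.
[cite: CoverThomas2006, Thm. 11.1.4 and Lemma 11.6.1; VassilevskaWilliamsXuXuZhou2024, §6.6 ("by concentration bounds")] -/
theorem typeClass_restriction_concentration (k : A → ℕ) (hk : ∑ a, k a = M) (P : Finset (Fin M)) {δ : ℝ} (hδ : 0 < δ) :
    (((typeClass M k).filter fun w => ∃ a, δ ≤ |(letterCountOn P w a : ℝ) / P.card - (k a : ℝ) / M|).card : ℝ) ≤
      ((P.card : ℝ) + 1) ^ Fintype.card A * ((M : ℝ) + 1) ^ Fintype.card A * Real.exp (-(P.card * δ ^ 2 / 2)) *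
        (typeClass M k).card := by
  classical
  set Bad := (typeClass M k).filter fun w => ∃ a, δ ≤ |(letterCountOn P w a : ℝ) / P.card - (k a : ℝ) / M| with hBad
  have hBadle : Bad.card ≤ (typeClass M k).card := card_le_card (filter_subset _ _)
  have hM1 : (1 : ℝ) ≤ ((M : ℝ) + 1) ^ Fintype.card A := one_le_pow₀ (by have := Nat.cast_nonneg (α := ℝ) M; linarith)
  rcases Nat.eq_zero_or_pos P.card with hm0 | hm
  · -- no positions: the bound is `≥ |T(k)|`
    rw [hm0, Nat.cast_zero, zero_add, one_pow, one_mul, zero_mul, zero_div, neg_zero, Real.exp_zero, mul_one]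
    calc (Bad.card : ℝ) ≤ (typeClass M k).card := by exact_mod_cast hBadle
      _ = 1 * (typeClass M k).card := (one_mul _).symm
      _ ≤ ((M : ℝ) + 1) ^ Fintype.card A * (typeClass M k).card := mul_le_mul_of_nonneg_right hM1 (Nat.cast_nonneg _)
  -- the possible count vectors on `P`
  set K : Finset (A → ℕ) := Fintype.piFinset fun _ => range (P.card + 1) with hK
  have hKcard : (K.card : ℝ) = ((P.card : ℝ) + 1) ^ Fintype.card A := by
    rw [hK, Fintype.card_piFinset, prod_const, card_range, card_univ]; push_cast; ring
  have hmemK : ∀ w ∈ Bad, letterCountOn P w ∈ K := fun w _ =>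
    Fintype.mem_piFinset.2 fun a => mem_range.2 (Nat.lt_succ_of_le (letterCountOn_le_card P w a))
  set B : ℝ := ((M : ℝ) + 1) ^ Fintype.card A * Real.exp (-(P.card * δ ^ 2 / 2)) * (typeClass M k).card with hB
  have hB0 : 0 ≤ B := by rw [hB]; positivity
  -- fibrewise bound
  have hfib : ∀ k' ∈ K, ((Bad.filter fun w => letterCountOn P w = k').card : ℝ) ≤ B := by
    intro k' _
    rcases (Bad.filter fun w => letterCountOn P w = k').eq_empty_or_nonempty with h0 | ⟨w₀, hw₀⟩
    · rw [h0, card_empty, Nat.cast_zero]; exact hB0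
    · rw [mem_filter] at hw₀
      obtain ⟨hw₀Bad, hw₀k'⟩ := hw₀
      rw [hBad, mem_filter] at hw₀Bad
      obtain ⟨-, a₀, ha₀⟩ := hw₀Bad
      rw [hw₀k'] at ha₀
      have hsub : (Bad.filter fun w => letterCountOn P w = k') ⊆ (typeClass M k).filter fun w => letterCountOn P w = k' :=
        fun w hw => by
          rw [mem_filter] at hw ⊢
          exact ⟨(mem_filter.1 hw.1).1, hw.2⟩
      calc ((Bad.filter fun w => letterCountOn P w = k').card : ℝ)
          ≤ (((typeClass M k).filter fun w => letterCountOn P w = k').card : ℝ) := by exact_mod_cast card_le_card hsub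
        _ ≤ B := card_fibre_le_of_far k hk P hm k' hδ ha₀
  have hsum := card_eq_sum_card_fiberwise (f := letterCountOn P) (s := Bad) (t := K) fun w hw => hmemK w hw
  calc (Bad.card : ℝ) = ∑ k' ∈ K, ((Bad.filter fun w => letterCountOn P w = k').card : ℝ) := by
        rw [hsum]; push_cast; rfl
    _ ≤ ∑ k' ∈ K, B := sum_le_sum hfib
    _ = K.card * B := by rw [sum_const, nsmul_eq_mul]
    _ = ((P.card : ℝ) + 1) ^ Fintype.card A * ((M : ℝ) + 1) ^ Fintype.card A * Real.exp (-(P.card * δ ^ 2 / 2)) *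
        (typeClass M k).card := by rw [hKcard, hB]; ring

end Concentration



end Literature.Computability.AlgebraicComplexity
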